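import Literature.MathematicalPhysics.QuantumFieldTheory.Federbush1986.ModeAnalyticityGaugeRepair

/-!
# Federbush–Williamson, *A phase cell approach to Yang–Mills theory. II. Analysis of a mode* (J. Math. Phys. **28**
# (1987) 1416–1419) [FederbushWilliamson1987PhaseCellII] — §V–§VI on the WHOLE PERIOD CELL: the lattice sums `D_j` of
# (5.3)/(6.5)–(6.7) are analytic on the wide tube `|Re p_j| < π + ½, |Im p_j| < ½` ((6.1), (6.8)), the split (5.3)
# `⟨1/p_j²⟩ = r₀e_j/(p²p_j²)` holds there, and the brackets (1.4) are `2π`-periodic ((3.1))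

statement-level skeleton of published theorems with citation tags; proofs where landed; nothing here is a claim about
the Yang–Mills mass gap

Cell `lit-balaban`, Phase-2 proof seat **p04** (gen 9), own lane F2 (rows `F2.Thm3.1`–`F2.Thm3.3` of
`run/shared/lean/pub/lit-balaban/lit-balaban-r17/SKELETON-r17.md`, owner r17, referee ref-5).  Source pages READ AS
IMAGES: `run/shared/lean/pub/pub-balaban/t4/b2b-balaban-t4-lit2/g7/fw1987II/fedwill1987-jmp28-II-p002-x2.png` (p. 1417:
(3.1) «f_i, D, 𝒟, and ⟨·⟩ are periodic functions of p, invariant under p → p + 2πn», Theorems 3.1–3.3, (5.1)) and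
`-p003-x2.png` (p. 1418: (5.2)–(5.10), §VI (6.1)–(6.14)).

WHY.  The printed Theorem 3.1 asserts analyticity of the mode on the whole period cell `𝒟_L = {−π ≤ Re p_j ≤ π,
|Im p_j| < ε₀}` (3.2); §VI argues through the functions `e_j` of (5.3) («(1) e_i(p) is analytic (6.1) … |K_ρ(p)| < m
(6.8)»).  Gen 5 of this seat (`ModeAnalyticityLatticeSums`, p249277) proved exactly this NEAR `p = 0` (the ball
`‖p‖ < ½`): `e_j = E_j = 1 + p²D_j` with `D_j` the `n ≠ 0` lattice sum, analytic by the Weierstrass M-test.  This file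
carries the same objects to the WIDE TUBE `W = {|Re p_j| < π + ½, |Im p_j| < ½} ⊃ 𝒟_L(½)`, which is what the sequel
(`ModeAnalyticityCellPositivity`, `ModeAnalyticityCorrectedGauge`, `ModeAnalyticityThms31to33Corrected`: Theorems
3.1–3.3 for the mode in the corrected gauge `X/(1+g)`) needs.  Nothing is re-declared: `D`, `termD`, `ratio`, `E`,
`ghat`, `r0`, `bterm`, `invSqBracket`, … are the tree's (gen 5/6, by name).

WHAT IS PROVED (kernel-checked; axioms standard; NO `Prop` definitions, NO named facts; the only `def`s are the tube
`Wt` and the dominating weights `bW`/`uW`).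
* §1–§2 the tube `Wt` and the lattice denominators on it: `|Re(p_i + 2πn_i)| ≥ (5/2)|n_i|` (`n_i ≠ 0`),
  `Re Σ_l(p_l + 2πn_l)² ≥ 5` (`n ≠ 0`) — the honest content of (6.8)–(6.10) on the cell.
* §3–§4 domination `‖termD_j(n,p)‖ ≤ uW(n)` by a summable product weight, hence **`analyticOnNhd_D_Wt`**: `D_j` is
  analytic on `Wt` ((6.1) «e_i(p) is analytic» on all of `𝒟_L`), with `E_j`, `ĝ` holomorphic there.
* §5 `r₀ ≠ 0` on `Wt` (`phiM_ne_zero_of_abs_re_lt`: `(e^{∓iz} − 1)/z ≠ 0` for `|Re z| < 2π`).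
* §6 **(5.3) on the cell**: `⟨1/p_j²⟩(p) = r₀E_j/(p²p_j²)` at every `p ∈ Wt` with all `p_i ≠ 0`, `p² ≠ 0`
  (`invSqBracket_eq_Wt`), and the determinant/numerator rewrites `scrD_eq_Wt`.
* §7 **(3.1) periodicity**: `⟨1/p_j²⟩(p + 2πm) = ⟨1/p_j²⟩(p)`, hence `𝒟`, `l_i`, `f̄₁` are `2π`-periodic
  (`invSqBracket_shift`, `scrD_shift`, `l_shift`, `fbar_shift`), for EVERY `p ∈ ℂ⁴` and `m ∈ ℤ⁴` (re-indexing of the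
  `tsum`, no convergence needed).
-/

noncomputable section

namespace Literature.MathematicalPhysics.QuantumFieldTheory.Federbush1986

namespace ModeAnalyticityWideTube

open ModeAnalyticity ModeAnalyticityLatticeSums ModeAnalyticityBracketSplit ModeAnalyticityGaugeRepair
  Complex Filter Topology Finset Metric Set
open scoped BigOperators Real

/-! ## §1. The wide tube around the period cell -/

/-- The wide tube `W = {p ∈ ℂ⁴ : |Re p_j| < π + ½, |Im p_j| < ½ (all j)}` — an open neighbourhood of the closed period
cell `−π ≤ Re p_j ≤ π` of (3.2) on which §VI's objects are studied. [cite: FederbushWilliamson1987PhaseCellII, (3.2)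
p. 1417, §VI p. 1418] -/
def Wt : Set Momentum := {p | ∀ j, |(p j).re| < π + 1 / 2 ∧ |(p j).im| < 1 / 2}

/-- (plumbing) `Wt` is open. [cite: FederbushWilliamson1987PhaseCellII, (3.2) p. 1417] -/
theorem isOpen_Wt : IsOpen Wt := by
  have e : Wt = ⋂ j : Fin 4, {p : Momentum | |(p j).re| < π + 1 / 2} ∩ {p | |(p j).im| < 1 / 2} := by
    ext p; simp [Wt]
  rw [e]
  refine isOpen_iInter_of_finite fun j => IsOpen.inter ?_ ?_
  · exact isOpen_lt (continuous_abs.comp (Complex.continuous_re.comp (continuous_apply j))) continuous_const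
  · exact isOpen_lt (continuous_abs.comp (Complex.continuous_im.comp (continuous_apply j))) continuous_const

/-- (plumbing) coordinate bounds on `Wt`. [cite: FederbushWilliamson1987PhaseCellII, (3.2) p. 1417] -/
theorem abs_re_lt_of_mem_Wt {p : Momentum} (hp : p ∈ Wt) (j : Fin 4) : |(p j).re| < π + 1 / 2 := (hp j).1

/-- (plumbing) coordinate bounds on `Wt`. [cite: FederbushWilliamson1987PhaseCellII, (3.2) p. 1417] -/
theorem abs_im_lt_of_mem_Wt {p : Momentum} (hp : p ∈ Wt) (j : Fin 4) : |(p j).im| < 1 / 2 := (hp j).2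

/-- (plumbing) `‖p_j‖ ≤ |Re p_j| + |Im p_j| < π + 1` on `Wt`. [cite: FederbushWilliamson1987PhaseCellII, (3.2) p. 1417] -/
theorem norm_apply_lt_of_mem_Wt {p : Momentum} (hp : p ∈ Wt) (j : Fin 4) : ‖p j‖ < π + 1 := by
  have h := Complex.norm_le_abs_re_add_abs_im (p j)
  have h1 := abs_re_lt_of_mem_Wt hp j
  have h2 := abs_im_lt_of_mem_Wt hp j
  linarith

/-- (plumbing) `‖p_j‖ ≤ 5` on `Wt` (a round constant). [cite: FederbushWilliamson1987PhaseCellII, (3.2) p. 1417] -/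
theorem norm_apply_le_five {p : Momentum} (hp : p ∈ Wt) (j : Fin 4) : ‖p j‖ ≤ 5 := by
  have := norm_apply_lt_of_mem_Wt hp j
  nlinarith [Real.pi_lt_d2]

/-- The ball `‖p‖ < ½` of gen 5 lies in the wide tube. [cite: FederbushWilliamson1987PhaseCellII, §V p. 1418] -/
theorem U_subset_Wt : U ⊆ Wt := by
  intro p hp j
  have h := norm_apply_lt_of_mem_U hp j
  refine ⟨?_, ?_⟩
  · have := Complex.abs_re_le_norm (p j); nlinarith [Real.pi_gt_three]
  · exact (Complex.abs_im_le_norm (p j)).trans_lt h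

/-! ## §2. Lattice denominators on the tube ((6.8)–(6.10) on the cell) -/

/-- `1 ≤ |m|` for a non-zero integer, cast to `ℝ`. [folklore] -/
private theorem one_le_abs_cast {m : ℤ} (h : m ≠ 0) : (1 : ℝ) ≤ |(m : ℝ)| := by
  rw [← Int.cast_abs]; exact_mod_cast Int.one_le_abs h

/-- For `n_i ≠ 0` and `p ∈ Wt`: `|Re(p_i + 2πn_i)| ≥ (5/2)|n_i|`. [cite: FederbushWilliamson1987PhaseCellII, (6.8)
p. 1418] -/
theorem abs_shift_re_ge {p : Momentum} (hp : p ∈ Wt) {n : Idx} {i : Fin 4} (hni : n i ≠ 0) :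
    5 / 2 * |(n i : ℝ)| ≤ |(shift p n i).re| := by
  have h1 := one_le_abs_cast hni
  have hre : |(p i).re| ≤ π + 1 / 2 := (abs_re_lt_of_mem_Wt hp i).le
  rw [shift_re]
  have h2 : |2 * π * (n i : ℝ)| = 2 * π * |(n i : ℝ)| := by
    rw [abs_mul, abs_of_pos (by positivity : (0:ℝ) < 2 * π)]
  have h3 : |2 * π * (n i : ℝ)| - |(p i).re| ≤ |(p i).re + 2 * π * (n i : ℝ)| := by
    have := abs_sub_abs_le_abs_sub (2 * π * (n i : ℝ)) (-(p i).re)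
    simpa [sub_neg_eq_add, add_comm, abs_neg] using this
  nlinarith [Real.pi_gt_three, Real.pi_lt_d2]

/-- For `n_i ≠ 0` and `p ∈ Wt`: `‖p_i + 2πn_i‖ ≥ (5/2)|n_i|`. [cite: FederbushWilliamson1987PhaseCellII, (6.8) p. 1418] -/
theorem norm_shift_ge {p : Momentum} (hp : p ∈ Wt) {n : Idx} {i : Fin 4} (hni : n i ≠ 0) :
    5 / 2 * |(n i : ℝ)| ≤ ‖shift p n i‖ :=
  (abs_shift_re_ge hp hni).trans (Complex.abs_re_le_norm _)

/-- (plumbing) `p_i + 2πn_i ≠ 0` on `Wt` for `n_i ≠ 0`. [cite: FederbushWilliamson1987PhaseCellII, (6.6)–(6.7) p. 1418] -/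
theorem shift_ne_zero {p : Momentum} (hp : p ∈ Wt) {n : Idx} {i : Fin 4} (hni : n i ≠ 0) :
    shift p n i ≠ 0 := by
  intro h
  have := norm_shift_ge hp hni
  rw [h, norm_zero] at this
  have := one_le_abs_cast hni
  linarith

/-- `Re(z²) = (Re z)² − (Im z)²`. [folklore] -/
private theorem sq_re (z : ℂ) : (z ^ 2).re = z.re ^ 2 - z.im ^ 2 := by
  rw [pow_two, Complex.mul_re]; ring

/-- For `n ≠ 0` and `p ∈ Wt`: `Re Σ_l (p_l + 2πn_l)² ≥ 5` ((6.10): `|Arg p²|` small off the origin cell's centre).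
[cite: FederbushWilliamson1987PhaseCellII, (6.8)–(6.10) p. 1418] -/
theorem re_csq_shift_ge {p : Momentum} (hp : p ∈ Wt) {n : Idx} (hn : n ≠ 0) :
    5 ≤ (csq (shift p n)).re := by
  obtain ⟨m, hm⟩ := Function.ne_iff.mp hn
  have hre : ∀ l, ((shift p n l) ^ 2).re = (shift p n l).re ^ 2 - (p l).im ^ 2 := fun l => by
    rw [sq_re, shift_im]
  have him : ∀ l, (p l).im ^ 2 ≤ 1 / 4 := fun l => by
    have h1 : |(p l).im| ≤ 1 / 2 := (abs_im_lt_of_mem_Wt hp l).le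
    have h2 : 0 ≤ |(p l).im| := abs_nonneg _
    nlinarith [sq_abs ((p l).im)]
  have hm' : 6 ≤ (shift p n m).re ^ 2 := by
    have h1 := abs_shift_re_ge hp hm
    have h2 := one_le_abs_cast hm
    nlinarith [sq_abs ((shift p n m).re), abs_nonneg ((n m : ℝ))]
  unfold csq
  rw [Complex.re_sum]
  simp_rw [hre]
  rw [Finset.sum_sub_distrib]
  have hA : (shift p n m).re ^ 2 ≤ ∑ l, (shift p n l).re ^ 2 :=
    Finset.single_le_sum (f := fun l => (shift p n l).re ^ 2) (fun l _ => sq_nonneg _) (Finset.mem_univ m)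
  have hB : ∑ l : Fin 4, (p l).im ^ 2 ≤ ∑ _l : Fin 4, (1 / 4 : ℝ) := Finset.sum_le_sum fun l _ => him l
  simp only [Finset.sum_const, Finset.card_univ, Fintype.card_fin, nsmul_eq_mul] at hB
  norm_num at hB
  linarith

/-- (plumbing) `‖Σ_l(p_l + 2πn_l)²‖ ≥ 5` on `Wt`, `n ≠ 0`. [cite: FederbushWilliamson1987PhaseCellII, (6.8) p. 1418] -/
theorem norm_csq_shift_ge {p : Momentum} (hp : p ∈ Wt) {n : Idx} (hn : n ≠ 0) : 5 ≤ ‖csq (shift p n)‖ :=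
  (re_csq_shift_ge hp hn).trans (Complex.re_le_norm _)

/-- (plumbing) `Σ_l(p_l + 2πn_l)² ≠ 0` on `Wt`, `n ≠ 0`. [cite: FederbushWilliamson1987PhaseCellII, (6.6)–(6.7) p. 1418] -/
theorem csq_shift_ne_zero {p : Momentum} (hp : p ∈ Wt) {n : Idx} (hn : n ≠ 0) : csq (shift p n) ≠ 0 := by
  intro h; have := norm_csq_shift_ge hp hn; rw [h, norm_zero] at this; linarith

/-! ## §3. The dominating weights on the tube -/

/-- One-dimensional weight on the tube: `bW(0) = 1`, `bW(m) = 3/m²` (`= 75·b(m)` of gen 5 off `0`). [folklore] -/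
def bW (m : ℤ) : ℝ := if m = 0 then 1 else 3 / (m : ℝ) ^ 2

/-- The product weight `uW(n) = ∏_i bW(n_i)`. [folklore] -/
def uW (n : Idx) : ℝ := ∏ i, bW (n i)

/-- (plumbing) [cite: FederbushWilliamson1987PhaseCellII, (6.8) p. 1418] -/
theorem bW_nonneg (m : ℤ) : 0 ≤ bW m := by
  unfold bW; split_ifs <;> positivity

/-- (plumbing) `bW ≤ 75·b`. [cite: FederbushWilliamson1987PhaseCellII, (6.8) p. 1418] -/
theorem bW_le (m : ℤ) : bW m ≤ 75 * b m := by
  unfold bW b; split_ifs with h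
  · norm_num
  · have h1 : (0 : ℝ) < (m : ℝ) ^ 2 := by
      have := one_le_abs_cast h; nlinarith [sq_abs (m : ℝ)]
    rw [div_le_iff₀ h1]
    field_simp
    nlinarith

/-- (plumbing) `bW ≤ 3`. [cite: FederbushWilliamson1987PhaseCellII, (6.8) p. 1418] -/
theorem bW_le_three (m : ℤ) : bW m ≤ 3 := by
  unfold bW; split_ifs with h
  · norm_num
  · have h1 : (1 : ℝ) ≤ (m : ℝ) ^ 2 := by
      have := one_le_abs_cast h; nlinarith [sq_abs (m : ℝ)]
    rw [div_le_iff₀ (by positivity)]; nlinarith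

/-- (plumbing) [cite: FederbushWilliamson1987PhaseCellII, (6.8) p. 1418] -/
theorem uW_nonneg (n : Idx) : 0 ≤ uW n := Finset.prod_nonneg fun i _ => bW_nonneg (n i)

/-- (plumbing) `uW ≤ 75⁴·u`. [cite: FederbushWilliamson1987PhaseCellII, (6.8) p. 1418] -/
theorem uW_le (n : Idx) : uW n ≤ 75 ^ 4 * u n := by
  unfold uW u
  calc ∏ i, bW (n i) ≤ ∏ i, (75 * b (n i)) :=
        Finset.prod_le_prod (fun i _ => bW_nonneg _) fun i _ => bW_le _
    _ = 75 ^ 4 * ∏ i, b (n i) := by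
        rw [Finset.prod_mul_distrib]; simp

/-- (plumbing) `uW ≤ 3⁴`. [cite: FederbushWilliamson1987PhaseCellII, (6.8) p. 1418] -/
theorem uW_le_const (n : Idx) : uW n ≤ 3 ^ 4 := by
  unfold uW
  calc ∏ i, bW (n i) ≤ ∏ _i : Fin 4, (3 : ℝ) :=
        Finset.prod_le_prod (fun i _ => bW_nonneg _) fun i _ => bW_le_three _
    _ = 3 ^ 4 := by simp

/-- (plumbing) summability of the product weight over `n ≠ 0`. [cite: FederbushWilliamson1987PhaseCellII, (6.8) p. 1418] -/
theorem summable_uW_NZ : Summable fun n : NZ => uW n.1 :=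
  Summable.of_nonneg_of_le (fun _ => uW_nonneg _) (fun _ => uW_le _) (summable_u_NZ.mul_left _)

/-! ## §4. Domination of the terms and analyticity of `D_j` on the tube ((6.1), (6.8)) -/

/-- `‖ratio_i‖ ≤ bW(n_i)` on the tube (all `i`). [cite: FederbushWilliamson1987PhaseCellII, (6.8) p. 1418] -/
theorem norm_ratio_le_bW {p : Momentum} (hp : p ∈ Wt) (n : Idx) (i : Fin 4) : ‖ratio n p i‖ ≤ bW (n i) := by
  by_cases h : n i = 0
  · simp [ratio_of_eq h, bW, h]
  · rw [ratio_of_ne h, norm_div, norm_pow, norm_pow]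
    unfold bW; rw [if_neg h]
    have h1 := norm_shift_ge hp h
    have h2 := one_le_abs_cast h
    have h3 : 25 / 4 * (n i : ℝ) ^ 2 ≤ ‖shift p n i‖ ^ 2 := by
      nlinarith [sq_abs ((n i : ℝ)), abs_nonneg ((n i : ℝ))]
    have h4 : ‖p i‖ ^ 2 ≤ 18 := by
      have := norm_apply_lt_of_mem_Wt hp i
      have h0 := norm_nonneg (p i)
      nlinarith [Real.pi_lt_d2]
    have h5 : (0 : ℝ) < (n i : ℝ) ^ 2 := by nlinarith [sq_abs ((n i : ℝ))]
    calc ‖p i‖ ^ 2 / ‖shift p n i‖ ^ 2 ≤ 18 / (25 / 4 * (n i : ℝ) ^ 2) :=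
          div_le_div₀ (by norm_num) h4 (by positivity) h3
      _ ≤ 3 / (n i : ℝ) ^ 2 := by
          rw [div_le_div_iff₀ (by positivity) h5]; nlinarith

/-- (plumbing) `‖ratio_i‖ ≤ 3` on the tube. [cite: FederbushWilliamson1987PhaseCellII, (6.8) p. 1418] -/
theorem norm_ratio_le_three {p : Momentum} (hp : p ∈ Wt) (n : Idx) (i : Fin 4) : ‖ratio n p i‖ ≤ 3 :=
  (norm_ratio_le_bW hp n i).trans (bW_le_three _)

/-- (plumbing) `‖∏_i ratio_i‖ ≤ uW(n)` on the tube. [cite: FederbushWilliamson1987PhaseCellII, (6.8) p. 1418] -/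
theorem norm_prod_ratio_le {p : Momentum} (hp : p ∈ Wt) (n : Idx) : ‖∏ i, ratio n p i‖ ≤ uW n := by
  rw [norm_prod]
  exact Finset.prod_le_prod (fun i _ => norm_nonneg _) fun i _ => norm_ratio_le_bW hp n i

/-- THE DOMINATION on the tube: `‖termD_j(n,p)‖ ≤ uW(n)` for `n ≠ 0`, `p ∈ Wt` (*"|K_ρ(p)| < m … for some fixed m"*,
(6.8), now on all of `𝒟_L`). [cite: FederbushWilliamson1987PhaseCellII, (6.8) p. 1418] -/
theorem norm_termD_le {p : Momentum} (hp : p ∈ Wt) (j : Fin 4) {n : Idx} (hn : n ≠ 0) :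
    ‖termD j n p‖ ≤ uW n := by
  unfold termD
  rw [norm_div, norm_mul]
  have h1 := norm_prod_ratio_le hp n
  have h2 := norm_ratio_le_three hp n j
  have h3 := norm_csq_shift_ge hp hn
  have h4 : ‖∏ i, ratio n p i‖ * ‖ratio n p j‖ ≤ uW n * 3 :=
    mul_le_mul h1 h2 (norm_nonneg _) (uW_nonneg n)
  rw [div_le_iff₀ (by linarith)]
  nlinarith [uW_nonneg n]

/-- (plumbing) summability of `Σ_{n≠0} ‖termD_j(n,p)‖` on the tube. [cite: FederbushWilliamson1987PhaseCellII, (6.8) p. 1418] -/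
theorem summable_norm_termD {p : Momentum} (hp : p ∈ Wt) (j : Fin 4) :
    Summable fun n : NZ => ‖termD j n.1 p‖ :=
  Summable.of_nonneg_of_le (fun _ => norm_nonneg _) (fun n => norm_termD_le hp j n.2) summable_uW_NZ

/-- (plumbing) summability of the `D_j` series on the tube. [cite: FederbushWilliamson1987PhaseCellII, (6.8) p. 1418] -/
theorem summable_termD {p : Momentum} (hp : p ∈ Wt) (j : Fin 4) : Summable fun n : NZ => termD j n.1 p :=
  (summable_norm_termD hp j).of_norm

/-- (plumbing for the cited display) quotients of holomorphic functions with non-vanishing denominator.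
[cite: FederbushWilliamson1987PhaseCellII, (6.1), (6.3) p. 1418] -/
theorem differentiableOn_div {f g : Momentum → ℂ} {s : Set Momentum} (hf : DifferentiableOn ℂ f s)
    (hg : DifferentiableOn ℂ g s) (h : ∀ p ∈ s, g p ≠ 0) : DifferentiableOn ℂ (fun p => f p / g p) s := by
  have e : (fun p => f p / g p) = fun p => f p * (g p)⁻¹ := funext fun p => div_eq_mul_inv _ _
  rw [e]; exact hf.mul (hg.inv h)

/-- (plumbing) [cite: FederbushWilliamson1987PhaseCellII, (6.1) p. 1418] -/
theorem differentiable_shift_apply (n : Idx) (i : Fin 4) : Differentiable ℂ (fun p : Momentum => shift p n i) :=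
  (differentiable_apply i).add (differentiable_const _)

/-- (plumbing) [cite: FederbushWilliamson1987PhaseCellII, (6.1) p. 1418] -/
theorem differentiableOn_ratio (n : Idx) (i : Fin 4) : DifferentiableOn ℂ (fun p : Momentum => ratio n p i) Wt := by
  by_cases h : n i = 0
  · simp only [ratio_of_eq h]; exact differentiableOn_const _
  · simp only [ratio_of_ne h]
    exact differentiableOn_div ((differentiable_apply i).pow 2).differentiableOn
      ((differentiable_shift_apply n i).pow 2).differentiableOn fun p hp => pow_ne_zero _ (shift_ne_zero hp h)

/-- (plumbing) [cite: FederbushWilliamson1987PhaseCellII, (6.1) p. 1418] -/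
theorem differentiable_csq_shift (n : Idx) : Differentiable ℂ (fun p : Momentum => csq (shift p n)) := by
  unfold csq
  exact Differentiable.fun_sum fun l _ => (differentiable_shift_apply n l).pow 2

/-- (plumbing) [cite: FederbushWilliamson1987PhaseCellII, (6.1) p. 1418] -/
theorem differentiableOn_prod_ratio (n : Idx) : DifferentiableOn ℂ (fun p : Momentum => ∏ i, ratio n p i) Wt := by
  simp only [Fin.prod_univ_four]
  exact (((differentiableOn_ratio n 0).mul (differentiableOn_ratio n 1)).mul (differentiableOn_ratio n 2)).mul
    (differentiableOn_ratio n 3)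

/-- Each term is holomorphic on the tube. [cite: FederbushWilliamson1987PhaseCellII, (6.1), (6.6)–(6.7) p. 1418] -/
theorem differentiableOn_termD (j : Fin 4) {n : Idx} (hn : n ≠ 0) : DifferentiableOn ℂ (termD j n) Wt := by
  unfold termD
  exact differentiableOn_div ((differentiableOn_prod_ratio n).mul (differentiableOn_ratio n j))
    (differentiable_csq_shift n).differentiableOn fun p hp => csq_shift_ne_zero hp hn

/-- **`D_j` is analytic on the wide tube `Wt ⊃ 𝒟_L(½)`** (normal convergence + Weierstrass) — (6.1) «e_i(p) is
analytic» with `e_i = 1 + p²D_i`, on the whole period cell. [cite: FederbushWilliamson1987PhaseCellII, (6.1), (6.8)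
p. 1418] -/
theorem analyticOnNhd_D_Wt (j : Fin 4) : AnalyticOnNhd ℂ (D j) Wt :=
  Literature.Analysis.Complex.SCV.analyticOnNhd_tsum_of_summable_norm (F := ℂ)
    (f := fun (n : NZ) (p : Momentum) => termD j n.1 p) isOpen_Wt (fun n => differentiableOn_termD j n.2)
    summable_uW_NZ (fun n _ hp => norm_termD_le hp j n.2)

/-- (plumbing) [cite: FederbushWilliamson1987PhaseCellII, (6.1) p. 1418] -/
theorem differentiableOn_D_Wt (j : Fin 4) : DifferentiableOn ℂ (D j) Wt := (analyticOnNhd_D_Wt j).differentiableOn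

/-- (plumbing) `p ↦ p²` is entire. [cite: FederbushWilliamson1987PhaseCellII, (1.4) p. 1416] -/
theorem analyticAt_csq (p : Momentum) : AnalyticAt ℂ csq p :=
  Literature.Analysis.Complex.SCV.analyticOnNhd_of_differentiableOn differentiable_csq.differentiableOn isOpen_univ p
    (Set.mem_univ p)

/-- `e_j = E_j = 1 + p²D_j` is analytic on the tube ((6.1)). [cite: FederbushWilliamson1987PhaseCellII, (6.1) p. 1418] -/
theorem analyticOnNhd_E_Wt (j : Fin 4) : AnalyticOnNhd ℂ (E j) Wt := fun p hp =>
  analyticAt_const.add ((analyticAt_csq p).mul (analyticOnNhd_D_Wt j p hp))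

/-- (plumbing) [cite: FederbushWilliamson1987PhaseCellII, (6.1) p. 1418] -/
theorem differentiableOn_E_Wt (j : Fin 4) : DifferentiableOn ℂ (E j) Wt := (analyticOnNhd_E_Wt j).differentiableOn

/-- (plumbing) the four `Q_k` of (6.14) are holomorphic on the tube. [cite: FederbushWilliamson1987PhaseCellII, (6.14)
p. 1418] -/
theorem differentiableOn_Q_Wt :
    DifferentiableOn ℂ Q0 Wt ∧ DifferentiableOn ℂ Q1 Wt ∧ DifferentiableOn ℂ Q2 Wt ∧ DifferentiableOn ℂ Q3 Wt := by
  have hD := differentiableOn_D_Wt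
  have hc : DifferentiableOn ℂ csq Wt := differentiable_csq.differentiableOn
  refine ⟨?_, ?_, ?_, ?_⟩
  · unfold Q0
    exact ((((hD 1).add (hD 2)).add (hD 3)).add (hc.mul ((((hD 1).mul (hD 2)).add ((hD 1).mul (hD 3))).add
      ((hD 2).mul (hD 3))))).add ((hc.pow 2).mul (((hD 1).mul (hD 2)).mul (hD 3)))
  · unfold Q1
    exact ((((hD 0).add (hD 2)).add (hD 3)).add (hc.mul ((((hD 0).mul (hD 2)).add ((hD 0).mul (hD 3))).add
      ((hD 2).mul (hD 3))))).add ((hc.pow 2).mul (((hD 0).mul (hD 2)).mul (hD 3)))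
  · unfold Q2
    exact ((((hD 0).add (hD 1)).add (hD 3)).add (hc.mul ((((hD 0).mul (hD 1)).add ((hD 0).mul (hD 3))).add
      ((hD 1).mul (hD 3))))).add ((hc.pow 2).mul (((hD 0).mul (hD 1)).mul (hD 3)))
  · unfold Q3
    exact ((((hD 0).add (hD 1)).add (hD 2)).add (hc.mul ((((hD 0).mul (hD 1)).add ((hD 0).mul (hD 2))).add
      ((hD 1).mul (hD 2))))).add ((hc.pow 2).mul (((hD 0).mul (hD 1)).mul (hD 2)))

/-- `ĝ` (the `g` of (6.11)/(6.14)) is holomorphic on the tube. [cite: FederbushWilliamson1987PhaseCellII, (6.11), (6.14)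
p. 1418] -/
theorem differentiableOn_ghat_Wt : DifferentiableOn ℂ ghat Wt := by
  obtain ⟨h0, h1, h2, h3⟩ := differentiableOn_Q_Wt
  have hsq : ∀ i : Fin 4, DifferentiableOn ℂ (fun p : Momentum => (p i) ^ 2) Wt := fun i =>
    ((differentiable_apply i).pow 2).differentiableOn
  unfold ghat
  exact ((((hsq 0).mul h0).add ((hsq 1).mul h1)).add ((hsq 2).mul h2)).add ((hsq 3).mul h3)

/-- (plumbing) `1 + ĝ` is analytic on the tube. [cite: FederbushWilliamson1987PhaseCellII, (6.13) p. 1418] -/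
theorem analyticOnNhd_one_add_ghat_Wt : AnalyticOnNhd ℂ (fun p => 1 + ghat p) Wt :=
  Literature.Analysis.Complex.SCV.analyticOnNhd_of_differentiableOn
    ((differentiableOn_const (1 : ℂ)).add differentiableOn_ghat_Wt) isOpen_Wt

/-! ## §5. `r₀ ≠ 0` on the tube -/

/-- `φ₋(z) = (e^{−iz} − 1)/z ≠ 0` whenever `|Re z| < 2π` (the only zeros of `e^{−iz} − 1` are `2πℤ`, and `φ₋(0) = −i`).
[cite: FederbushWilliamson1987PhaseCellII, (5.4) p. 1418] -/
theorem phiM_ne_zero_of_abs_re_lt {z : ℂ} (hz : |z.re| < 2 * π) : phiM z ≠ 0 := by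
  by_cases h0 : z = 0
  · rw [h0, phiM_zero]; exact neg_ne_zero.mpr I_ne_zero
  rw [phiM_of_ne h0]
  refine div_ne_zero (sub_ne_zero.mpr fun h => ?_) h0
  obtain ⟨k, hk⟩ := Complex.exp_eq_one_iff.mp h
  have hzk : z = -(k : ℂ) * (2 * π) := by
    have hI : (I : ℂ) ≠ 0 := I_ne_zero
    have : -I * z * I = k * (2 * π * I) * I := by rw [hk]
    have e1 : -I * z * I = z := by ring_nf; rw [I_sq]; ring
    have e2 : (k : ℂ) * (2 * π * I) * I = -(k : ℂ) * (2 * π) := by ring_nf; rw [I_sq]; ring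
    rw [e1, e2] at this; exact this
  have hre : z.re = -(k : ℝ) * (2 * π) := by
    rw [hzk]; simp
  by_cases hk0 : k = 0
  · apply h0; rw [hzk, hk0]; simp
  · have h1 := one_le_abs_cast hk0
    rw [hre, abs_mul, abs_neg, abs_of_pos (by positivity : (0:ℝ) < 2 * π)] at hz
    nlinarith [Real.pi_pos]

/-- `φ₊(z) = (e^{iz} − 1)/z ≠ 0` whenever `|Re z| < 2π`. [cite: FederbushWilliamson1987PhaseCellII, (5.4) p. 1418] -/
theorem phiP_ne_zero_of_abs_re_lt {z : ℂ} (hz : |z.re| < 2 * π) : phiP z ≠ 0 := by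
  by_cases h0 : z = 0
  · rw [h0, phiP_zero]; exact I_ne_zero
  rw [phiP_of_ne h0]
  refine div_ne_zero (sub_ne_zero.mpr fun h => ?_) h0
  obtain ⟨k, hk⟩ := Complex.exp_eq_one_iff.mp h
  have hzk : z = (k : ℂ) * (2 * π) := by
    have : I * z * I = k * (2 * π * I) * I := by rw [hk]
    have e1 : I * z * I = -z := by ring_nf; rw [I_sq]; ring
    have e2 : (k : ℂ) * (2 * π * I) * I = -((k : ℂ) * (2 * π)) := by ring_nf; rw [I_sq]; ring
    rw [e1, e2] at this; exact neg_inj.mp this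
  have hre : z.re = (k : ℝ) * (2 * π) := by
    rw [hzk]; simp
  by_cases hk0 : k = 0
  · apply h0; rw [hzk, hk0]; simp
  · have h1 := one_le_abs_cast hk0
    rw [hre, abs_mul, abs_of_pos (by positivity : (0:ℝ) < 2 * π)] at hz
    nlinarith [Real.pi_pos]

/-- **`r₀(p) ≠ 0` on the tube** (indeed whenever all `|Re p_i| < 2π`): (5.4) is invertible on the whole cell («We have
already used the analyticity in 𝒟_L of r_L, p₁f̄₁⁻¹, and r₀⁻¹», p. 1418). [cite: FederbushWilliamson1987PhaseCellII,
(5.4), (5.10) p. 1418] -/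
theorem r0_ne_zero_Wt {p : Momentum} (hp : p ∈ Wt) : r0 p ≠ 0 := by
  unfold r0
  have h2 : ∀ i, |(p i).re| < 2 * π := fun i => by
    have := abs_re_lt_of_mem_Wt hp i; nlinarith [Real.pi_gt_three]
  exact Finset.prod_ne_zero_iff.mpr fun i _ =>
    mul_ne_zero (phiM_ne_zero_of_abs_re_lt (h2 i)) (phiP_ne_zero_of_abs_re_lt (h2 i))

/-- (plumbing) `r₀` is analytic on the tube (it is entire). [cite: FederbushWilliamson1987PhaseCellII, (5.4) p. 1418] -/
theorem analyticOnNhd_r0 (s : Set Momentum) : AnalyticOnNhd ℂ r0 s := fun p _ => analyticAt_r0 p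

/-- (plumbing) `Φ` is analytic on any set (it is entire). [cite: FederbushWilliamson1987PhaseCellII, (5.1) p. 1417] -/
theorem analyticOnNhd_Phi (s : Set Momentum) : AnalyticOnNhd ℂ Phi s := fun p _ => analyticAt_Phi p

/-! ## §6. (5.3) on the tube: `⟨1/p_j²⟩ = r₀E_j/(p²p_j²)` -/

/-- (plumbing) all lattice denominators are non-zero at a point of the tube with all `p_i ≠ 0`.
[cite: FederbushWilliamson1987PhaseCellII, (1.4) p. 1416] -/
theorem shift_ne_zero' {p : Momentum} (hW : p ∈ Wt) (hp : ∀ i, p i ≠ 0) (n : Idx) (i : Fin 4) : shift p n i ≠ 0 := by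
  by_cases h : n i = 0
  · have : shift p n i = p i := by rw [shift_apply, h]; simp
    rw [this]; exact hp i
  · exact shift_ne_zero hW h

/-- For `n ≠ 0` the bracket term is `(r₀/p_j²)·termD_j(n,p)` on the tube. [cite: FederbushWilliamson1987PhaseCellII,
(5.3), (6.5) p. 1418] -/
theorem bterm_eq_of_ne {p : Momentum} (hW : p ∈ Wt) (hp : ∀ i, p i ≠ 0) (j : Fin 4) {n : Idx} (hn : n ≠ 0) :
    bterm j p n = r0 p / (p j) ^ 2 * termD j n p := by
  have hq : ∀ i, shift p n i ≠ 0 := shift_ne_zero' hW hp n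
  have hc : csq (shift p n) ≠ 0 := csq_shift_ne_zero hW hn
  unfold bterm termD
  rw [Finset.prod_div_distrib, ← r0_mul_prod_sq hp]
  simp only [ratio_eq_div hp, Fin.prod_univ_four]
  have h0 := hq 0; have h1 := hq 1; have h2 := hq 2; have h3 := hq 3
  have hp0 := hp 0; have hp1 := hp 1; have hp2 := hp 2; have hp3 := hp 3; have hpj := hp j; have hqj := hq j
  field_simp

/-- The equivalence between the two presentations of the non-zero lattice vectors. [folklore] -/
def nzEquiv' : NZ ≃ {x : Idx // x ∉ ({0} : Finset Idx)} :=
  Equiv.subtypeEquivRight fun x => by simp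

/-- Summability of the typed bracket series on the tube. [cite: FederbushWilliamson1987PhaseCellII, (1.4) p. 1416] -/
theorem summable_bterm {p : Momentum} (hW : p ∈ Wt) (hp : ∀ i, p i ≠ 0) (j : Fin 4) : Summable (bterm j p) := by
  have h1 : Summable fun n : NZ => r0 p / (p j) ^ 2 * termD j n.1 p := (summable_termD hW j).mul_left _
  have h2 : Summable fun n : NZ => bterm j p n.1 :=
    h1.congr fun n => (bterm_eq_of_ne hW hp j n.2).symm
  have h3 : Summable fun x : {x : Idx // x ∉ ({0} : Finset Idx)} => bterm j p x.1 :=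
    (nzEquiv'.summable_iff (f := fun x : {x : Idx // x ∉ ({0} : Finset Idx)} => bterm j p x.1)).mp h2
  exact (Finset.summable_compl_iff ({0} : Finset Idx)).mp h3

/-- **(5.3) on the whole tube**: `⟨1/p_j²⟩(p) = r₀(p)·E_j(p)/(p²·p_j²)` at every `p ∈ Wt` with all `p_i ≠ 0` and
`p² ≠ 0`. [cite: FederbushWilliamson1987PhaseCellII, (5.3) p. 1418] -/
theorem invSqBracket_eq_Wt {p : Momentum} (hW : p ∈ Wt) (hp : ∀ i, p i ≠ 0) (hc : csq p ≠ 0) (j : Fin 4) :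
    invSqBracket j p = r0 p * E j p / (csq p * (p j) ^ 2) := by
  rw [invSqBracket_eq_tsum]
  have hsum := summable_bterm hW hp j
  rw [← hsum.sum_add_tsum_subtype_compl {0}, Finset.sum_singleton, bterm_zero hp hc j]
  have e1 : ∑' x : {x : Idx // x ∉ ({0} : Finset Idx)}, bterm j p x.1 = ∑' n : NZ, bterm j p n.1 :=
    (nzEquiv'.tsum_eq (fun x : {x : Idx // x ∉ ({0} : Finset Idx)} => bterm j p x.1)).symm
  have e2 : ∑' n : NZ, bterm j p n.1 = ∑' n : NZ, r0 p / (p j) ^ 2 * termD j n.1 p :=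
    tsum_congr fun n => bterm_eq_of_ne hW hp j n.2
  rw [e1, e2, tsum_mul_left]
  change r0 p / (csq p * (p j) ^ 2) + r0 p / (p j) ^ 2 * D j p = r0 p * E j p / (csq p * (p j) ^ 2)
  unfold E
  field_simp

/-- **(1.18) via (5.3) on the tube**: `𝒟 = 16·r₀³·p²(1+ĝ)/((p²)³(p₁p₂p₃p₄)²)` at every generic point of `Wt` (all
`p_i ≠ 0`, `p² ≠ 0`). [cite: FederbushWilliamson1987PhaseCellII, (1.18) p. 1417, (5.3), (6.11) p. 1418] -/
theorem scrD_eq_Wt {p : Momentum} (hW : p ∈ Wt) (hp : ∀ i, p i ≠ 0) (hc : csq p ≠ 0) :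
    scrD p = 16 * (r0 p ^ 3 * (csq p * (1 + ghat p)) / (csq p ^ 3 * (p 0 * p 1 * p 2 * p 3) ^ 2)) := by
  rw [scrD_expand, invSqBracket_eq_Wt hW hp hc 0, invSqBracket_eq_Wt hW hp hc 1, invSqBracket_eq_Wt hW hp hc 2,
    invSqBracket_eq_Wt hW hp hc 3, ← den_eq]
  have hp0 := hp 0; have hp1 := hp 1; have hp2 := hp 2; have hp3 := hp 3
  field_simp

/-- **(2.2) via (5.3) on the tube**: `l₁ = r₀²·N/((p²)²(p₂p₃p₄)²)`. [cite: FederbushWilliamson1987PhaseCellII, (2.2)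
p. 1417, (5.5) p. 1418] -/
theorem l_zero_eq_Wt {p : Momentum} (hW : p ∈ Wt) (hp : ∀ i, p i ≠ 0) (hc : csq p ≠ 0) :
    l 0 p = r0 p ^ 2 * Nn p / (csq p ^ 2 * (p 1 * p 2 * p 3) ^ 2) := by
  rw [l_zero, invSqBracket_eq_Wt hW hp hc 1, invSqBracket_eq_Wt hW hp hc 2, invSqBracket_eq_Wt hW hp hc 3]
  unfold Nn
  have hp1 := hp 1; have hp2 := hp 2; have hp3 := hp 3
  field_simp

/-! ## §7. (3.1): the brackets, `𝒟`, `l_i`, `f̄₁` are `2π`-periodic -/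

/-- (plumbing) `(p + 2πm) + 2πn = p + 2π(m + n)`. [cite: FederbushWilliamson1987PhaseCellII, (3.1) p. 1417] -/
theorem shift_shift (p : Momentum) (m n : Idx) : shift (shift p m) n = shift p (m + n) := by
  funext i; simp only [shift_apply, Pi.add_apply, Int.cast_add]; ring

/-- (plumbing) `e^{∓i(p_i + 2πm_i)} = e^{∓ip_i}`. [cite: FederbushWilliamson1987PhaseCellII, (3.1) p. 1417] -/
theorem exp_neg_I_mul_shift (p : Momentum) (m : Idx) (i : Fin 4) : exp (-I * shift p m i) = exp (-I * p i) := by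
  rw [shift_apply, mul_add, Complex.exp_add]
  have : exp (-I * (2 * π * (m i : ℂ))) = 1 := by
    have e : -I * (2 * π * (m i : ℂ)) = ((-(m i) : ℤ) : ℂ) * (2 * π * I) := by push_cast; ring
    rw [e]; exact Complex.exp_int_mul_two_pi_mul_I _
  rw [this, mul_one]

/-- (plumbing) `e^{i(p_i + 2πm_i)} = e^{ip_i}`. [cite: FederbushWilliamson1987PhaseCellII, (3.1) p. 1417] -/
theorem exp_I_mul_shift (p : Momentum) (m : Idx) (i : Fin 4) : exp (I * shift p m i) = exp (I * p i) := by
  rw [shift_apply, mul_add, Complex.exp_add]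
  have : exp (I * (2 * π * (m i : ℂ))) = 1 := by
    have e : I * (2 * π * (m i : ℂ)) = ((m i : ℤ) : ℂ) * (2 * π * I) := by ring
    rw [e]; exact Complex.exp_int_mul_two_pi_mul_I _
  rw [this, mul_one]

/-- «f̄_i … periodic» (3.1). [cite: FederbushWilliamson1987PhaseCellII, (3.1) p. 1417] -/
theorem fbar_shift (p : Momentum) (m : Idx) (i : Fin 4) : fbar (shift p m) i = fbar p i := by
  unfold fbar; rw [exp_I_mul_shift]

/-- (plumbing) the `n`-th bracket term at `p + 2πm` is the `(m+n)`-th term at `p`.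
[cite: FederbushWilliamson1987PhaseCellII, (1.4) p. 1416, (3.1) p. 1417] -/
theorem bterm_shift (j : Fin 4) (p : Momentum) (m n : Idx) : bterm j (shift p m) n = bterm j p (m + n) := by
  unfold bterm
  rw [shift_shift]
  simp_rw [exp_neg_I_mul_shift, exp_I_mul_shift]

/-- **(3.1) for the brackets**: `⟨1/p_j²⟩(p + 2πm) = ⟨1/p_j²⟩(p)` for every `p ∈ ℂ⁴`, `m ∈ ℤ⁴` («⟨·⟩ are periodic functions
of p, invariant under p → p + 2πn»; a re-indexing of the lattice sum). [cite: FederbushWilliamson1987PhaseCellII, (3.1)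
p. 1417] -/
theorem invSqBracket_shift (j : Fin 4) (p : Momentum) (m : Idx) : invSqBracket j (shift p m) = invSqBracket j p := by
  rw [invSqBracket_eq_tsum, invSqBracket_eq_tsum]
  simp_rw [bterm_shift]
  exact (Equiv.addLeft m).tsum_eq (bterm j p)

/-- **(3.1) for `𝒟`** (1.18). [cite: FederbushWilliamson1987PhaseCellII, (1.18), (3.1) p. 1417] -/
theorem scrD_shift (p : Momentum) (m : Idx) : scrD (shift p m) = scrD p := by
  unfold scrD; simp_rw [invSqBracket_shift]

/-- **(3.1) for `l_i`** (2.2)–(2.3). [cite: FederbushWilliamson1987PhaseCellII, (2.2)–(2.3), (3.1) p. 1417] -/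
theorem l_shift (i : Fin 4) (p : Momentum) (m : Idx) : l i (shift p m) = l i p := by
  unfold l; simp_rw [invSqBracket_shift]

end ModeAnalyticityWideTube

end Literature.MathematicalPhysics.QuantumFieldTheory.Federbush1986
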